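import Summits.Ventures.HodgeRepro.FaceLatticeCore
import Summits.Ventures.HodgeRepro.Night3ClosureAbstract

/-!
# The CM pieces as multisets, and «S4-faces ⟹ S4» conditional on Lemma L

Blind re-derivation cell `pub-hodge-repro`, seat `night-3`.  Mathlib + typer-2's `FaceLatticeCore` + `Night3ClosureAbstract`.
Namespace `HodgeRepro.Night3` (the vocabulary of `FaceLatticeCore` and of `Night3ClosureAbstract` is `open`ed, never re-declared).

This file instantiates the abstract closure principle (`Abstract.alg_of_pieces`) with the CM objects of `FaceLatticeCore`:
CM types as sign vectors `CMType m := Fin m → Bool`, the zero-sum lattice `zeroSum m`, the conjugate pairs `pairVec` and the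
census faces `faceVec`.

* `IsZeroSum M` (`toVec M ∈ zeroSum m`) with its elementary reading `isZeroSum_iff`: at every place, as many members
  contain the fixed embedding as do not — (eq2) of ROUTE.md §3.6;
* the piece multisets `pairMul T = {T, T̄}`, `faceMul Φ p p′ = {Φ, flip p Φ̄, flip p′ Φ̄, flip p′ (flip p Φ)}`, `pieces m`;
  `image_toVec_pieces : toVec '' pieces m = pairs m ∪ faces m` (the bridge to `FaceLatticeCore`'s vectors);
* **`alg_of_faces_of_spanEq`**: the closure principle «S4-faces ⟹ S4» for `m` places, CONDITIONAL on Lemma L for that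
  `m` (`hL : Submodule.span ℤ (pairs m ∪ faces m) = zeroSum m`) — discharged by typer-2's `FaceLattice.span_pairs_faces_eq_zeroSum`
  for every `m ≥ 1` (`Night3FaceClosure.alg_of_faces`) and by night-3's engine certificate for `m ≤ 8`
  (`Night3FaceClosureEngine.alg_of_faces_le_eight`).

Reading of the hypotheses (the route's objects): `M` ↦ the corner product `B_M = ∏_{T ∈ M} A_T`; `Alg M` = «the Weil space
`W_F(B_M)` is algebraic»; `hadd` = Lemma P step (1); `hcancel` = Lemma P steps (2)–(3); `hpair` = Lefschetz (1,1);
`hface` = S4 on the census faces (the route's open input).  Nothing here closes S4; no sealed file is touched; no Tier-2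
item depends on this file.
-/

set_option autoImplicit false

namespace HodgeRepro.Night3

open Finset
open HodgeRepro.FaceLattice
open HodgeRepro.Night3.Abstract

variable {m : ℕ}

/-! ### Zero-sum multisets of CM types -/

/-- A multiset of CM types is ZERO-SUM when its count vector lies in the lattice `zeroSum m`: every embedding of `F` lies
in exactly half of the members (for `|M| = 2p`, the condition under which the Weil space of `B_M` has Hodge type `(p, p)`). -/
def IsZeroSum (M : Multiset (CMType m)) : Prop := toVec M ∈ zeroSum m

/-- `IsZeroSum` is `IsZeroSumIn` for the lattice `zeroSum m`. -/
theorem isZeroSum_iff_isZeroSumIn (M : Multiset (CMType m)) : IsZeroSum M ↔ IsZeroSumIn (zeroSum m) M := Iff.rfl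

/-- The weight of a count vector at a place: members containing the fixed embedding minus members not containing it. -/
theorem weight_toVec (i : Fin m) (M : Multiset (CMType m)) :
    weight i (toVec M) =
      ((M.filter fun T => T i = true).card : ℤ) - ((M.filter fun T => T i = false).card : ℤ) := by
  rw [weight_apply, ← Multiset.sum_count_eq_card (s := Finset.univ) (fun _ _ => Finset.mem_univ _),
    ← Multiset.sum_count_eq_card (s := Finset.univ) (fun _ _ => Finset.mem_univ _)]
  push_cast
  rw [← Finset.sum_sub_distrib]
  refine Finset.sum_congr rfl fun T _ => ?_
  cases hT : T i <;> simp [toVec_apply, sgn, hT]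

/-- The elementary reading of `IsZeroSum`: at every place, as many members contain the fixed embedding as do not. -/
theorem isZeroSum_iff (M : Multiset (CMType m)) :
    IsZeroSum M ↔ ∀ i, (M.filter fun T => T i = true).card = (M.filter fun T => T i = false).card := by
  unfold IsZeroSum
  rw [mem_zeroSum]
  refine forall_congr' fun i => ?_
  rw [weight_toVec, sub_eq_zero, Nat.cast_inj]

/-! ### The pieces: conjugate pairs and census faces as multisets -/

/-- The conjugate pair `{T, T̄}`. -/
def pairMul (T : CMType m) : Multiset (CMType m) := {T, conj T}

/-- The quadruple `{a, b, c, d}`. -/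
def quadMul (a b c d : CMType m) : Multiset (CMType m) := {a, b, c, d}

/-- The census face `(Φ; p, p′)` as a multiset: corners `Φ, flip p Φ̄, flip p′ Φ̄, flip p′ (flip p Φ)`. -/
def faceMul (Φ : CMType m) (p p' : Fin m) : Multiset (CMType m) :=
  quadMul Φ (FaceLattice.flip p (conj Φ)) (FaceLattice.flip p' (conj Φ)) (FaceLattice.flip p' (FaceLattice.flip p Φ))

/-- The pieces: all conjugate pairs and all census faces `(Φ; p, p′)`, `p ≠ p′`. -/
def pieces (m : ℕ) : Set (Multiset (CMType m)) :=
  Set.range pairMul ∪ {M | ∃ Φ p p', p ≠ p' ∧ M = faceMul Φ p p'}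

/-- The count vector of a singleton CM type is `FaceLatticeCore`'s basis vector `e`. -/
theorem toVec_singleton_eq_e (T : CMType m) : toVec ({T} : Multiset (CMType m)) = e T := toVec_singleton T

/-- The count vector of `T ::ₘ M`, with `FaceLatticeCore`'s `e`. -/
theorem toVec_cons_eq (T : CMType m) (M : Multiset (CMType m)) : toVec (T ::ₘ M) = e T + toVec M := toVec_cons T M

/-- The count vector of a pair is `pairVec`. -/
theorem toVec_pairMul (T : CMType m) : toVec (pairMul T) = pairVec T := by
  rw [pairMul, pairVec, Multiset.insert_eq_cons, toVec_cons_eq, toVec_singleton_eq_e]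

/-- The count vector of a quadruple. -/
theorem toVec_quadMul (a b c d : CMType m) : toVec (quadMul a b c d) = e a + e b + e c + e d := by
  rw [quadMul, Multiset.insert_eq_cons, Multiset.insert_eq_cons, Multiset.insert_eq_cons, toVec_cons_eq, toVec_cons_eq,
    toVec_cons_eq, toVec_singleton_eq_e]
  abel

/-- The count vector of a census face is `faceVec`. -/
theorem toVec_faceMul (Φ : CMType m) (p p' : Fin m) : toVec (faceMul Φ p p') = faceVec Φ p p' := by
  rw [faceMul, toVec_quadMul, faceVec]

/-- The count vectors of the pieces are exactly `FaceLatticeCore`'s pairs and faces. -/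
theorem image_toVec_pieces : toVec '' pieces m = pairs m ∪ faces m := by
  ext x
  constructor
  · rintro ⟨M, (⟨T, rfl⟩ | ⟨Φ, p, p', h, rfl⟩), rfl⟩
    · exact Or.inl ⟨T, (toVec_pairMul T).symm⟩
    · exact Or.inr ⟨Φ, p, p', h, toVec_faceMul Φ p p'⟩
  · rintro (⟨T, rfl⟩ | ⟨Φ, p, p', h, rfl⟩)
    · exact ⟨pairMul T, Or.inl ⟨T, rfl⟩, toVec_pairMul T⟩
    · exact ⟨faceMul Φ p p', Or.inr ⟨Φ, p, p', h, rfl⟩, toVec_faceMul Φ p p'⟩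

/-- Pieces are zero-sum. -/
theorem isZeroSum_of_mem_pieces {M : Multiset (CMType m)} (hM : M ∈ pieces m) : IsZeroSum M := by
  rcases hM with ⟨T, rfl⟩ | ⟨Φ, p, p', h, rfl⟩
  · unfold IsZeroSum; rw [toVec_pairMul]; exact pairVec_mem T
  · unfold IsZeroSum; rw [toVec_faceMul]; exact faceVec_mem h Φ

/-- There is always a piece (a pair). -/
theorem pieces_nonempty : (pieces m).Nonempty :=
  ⟨pairMul (fun _ => true), Or.inl ⟨_, rfl⟩⟩

/-- `M` is a sum of pieces: an ℕ-combination of pairs and census faces. -/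
theorem isPieceSum_iff (M : Multiset (CMType m)) :
    IsPieceSum (pieces m) M ↔ toVec M ∈ AddSubmonoid.closure (pairs m ∪ faces m) := by
  rw [← image_toVec_pieces, toVec_mem_closure_iff]

/-- **The Consequence of Lemma L in multiset form**, conditional on Lemma L for `m`: for every zero-sum multiset `M` there
is a sum of pieces `N` such that `M + N` is a sum of pieces. -/
theorem exists_pieces_add_pieces_of_spanEq (hL : Submodule.span ℤ (pairs m ∪ faces m) = zeroSum m)
    {M : Multiset (CMType m)} (hM : IsZeroSum M) :
    ∃ N : Multiset (CMType m), IsPieceSum (pieces m) N ∧ IsPieceSum (pieces m) (M + N) :=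
  Abstract.exists_pieces_add_pieces (pieces m) (zeroSum m) (by rw [image_toVec_pieces, hL]) hM

/-- **«S4-faces ⟹ S4», conditional on Lemma L for `m` places** (`hL`; Lemma L holds for every `m ≥ 1`).  For any
predicate `Alg` on multisets of CM types with

* `hadd` (product closure, Lemma P (1)): `Alg M → Alg N → Alg (M + N)` for zero-sum `M`, `N`;
* `hcancel` (cancellation, Lemma P (2)–(3)): `Alg (M + N) → Alg N → Alg M` for zero-sum `M`, `N`;
* `hpair` (divisor classes, Lefschetz (1,1)): `Alg {T, T̄}` for every CM type `T`;
* `hface` (S4 on the census faces): `Alg {Φ, flip p Φ̄, flip p′ Φ̄, flip p′ (flip p Φ)}` for every `Φ` and `p ≠ p′`,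

`Alg M` holds for EVERY zero-sum multiset `M`. -/
theorem alg_of_faces_of_spanEq (hL : Submodule.span ℤ (pairs m ∪ faces m) = zeroSum m)
    (Alg : Multiset (CMType m) → Prop)
    (hadd : ∀ M N, IsZeroSum M → IsZeroSum N → Alg M → Alg N → Alg (M + N))
    (hcancel : ∀ M N, IsZeroSum M → IsZeroSum N → Alg (M + N) → Alg N → Alg M)
    (hpair : ∀ T, Alg (pairMul T))
    (hface : ∀ Φ p p', p ≠ p' → Alg (faceMul Φ p p'))
    (M : Multiset (CMType m)) (hM : IsZeroSum M) : Alg M := by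
  refine Abstract.alg_of_pieces (pieces m) (zeroSum m) (fun p hp => isZeroSum_of_mem_pieces hp)
    (by rw [image_toVec_pieces, hL]) pieces_nonempty Alg hadd hcancel ?_ M hM
  rintro _ (⟨T, rfl⟩ | ⟨Φ, p, p', h, rfl⟩)
  · exact hpair T
  · exact hface Φ p p' h

end HodgeRepro.Night3
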